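import Summits.CriticalPhenomena.PercolationContinuityZ3.Theorems.PercNearOneGluingNoHeavyQuantFarTreeComb
import HarnessLib

/-!
# QUANT lane R8: FAR at every layer on combs — ROUTE VOCABULARY (tree-supported weights on the pairs of `Fin n`)

builds on p205010 (kernel theorem, internal audit signed; external expert review pending)

Support file (`--supports stmt-CriticalPhenomena-4575`), QUANT lane seat prim-quant-p1 (gen 6), rung R8 of
`run/shared/lean/prim/quant/LADDER.md`; memo `P1-SURPLUS.md` §17.  Theorems only; no sorries; standard axioms.

`Quant.farTreeRow_comb` (`…QuantFarTreeComb.lean`) proves the conclusion of `Quant.FarTreeRow` at every layer for combs in gate coordinates.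
Here it is carried to the vocabulary of `Quant.FarRelayRow` (`prodBernoulli w` on `Sym2 (Fin n)`, events `openConn`) for weights supported on a
rooted spanning tree (`par`/`depth` coordinates of `Quant.tree_cluster_transfer`; weight `0` prunes), exactly as `Quant.farRelayRow_tree_of_farTreeRow`
does for the full (open) tree row:

* `Quant.farRelayRow_tree_comb_notMem` / `Quant.farRelayRow_tree_comb` — **the body of `Quant.FarRelayRow` at EVERY layer `j`** for tree-supported `w`,
  a relay set `A` with a least likely relay `a ∈ A` (`P(o ↔ a) ≤ P(o ↔ b)` on `A`, `a ≠ o`) such that any two other relays `b ≠ b'` of `A ∖ o` have all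
  their common ancestors-or-self on `a`'s ancestral line (`{par^[i] b} ∩ {par^[i] b'} ⊆ {par^[i] a}`: the COMB condition — `b` and `b'` leave the path
  `o → a` at vertices from which they continue by disjoint private paths; relays on the path and several single-relay hairs at one vertex allowed):
  `2j < Σ_{b∈A} P(o ↔ b)` and `P(o ↮ b) ≤ t` on `A` imply `P(#{b ∈ A | o ↔ b} ≤ j) ≤ t`.  (`o ∈ A` is allowed: shift `(A, j) ↦ (A ∖ o, j − 1)`.)
Proof: `Quant.tree_relayCount_transfer` + `Quant.tree_ancestor_axioms` + `Quant.tree_real_openConn_eq_prod` (as in `…QuantFarTreeRow.lean`) reduce to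
`Quant.farTreeRow_comb`. [this work]
-/

noncomputable section

namespace Summit.CriticalPhenomena.PercolationContinuityZ3.Theorems

namespace Quant

open Finset MeasureTheory
open Literature.Probability.LatticeModels
open Literature.Probability.Percolation
open scoped Classical

variable {n : ℕ}

/-- **FAR at every layer on combs, route vocabulary, `o ∉ A` cell.**  See the file header. [this work] -/
theorem farRelayRow_tree_comb_notMem (n : ℕ) (w : Sym2 (Fin n) → unitInterval) (o : Fin n)
    (depth : Fin n → ℕ) (par : Fin n → Fin n)
    (hroot : ∀ x, x ≠ o → depth x = 0 → par x = o)
    (hstep : ∀ x, x ≠ o → depth x ≠ 0 → par x ≠ o ∧ depth (par x) + 1 = depth x)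
    (hsupp : ∀ e, w e ≠ 0 → e.IsDiag ∨ ∃ x, x ≠ o ∧ e = s(par x, x))
    (A : Finset (Fin n)) (hoA : o ∉ A) (a : Fin n) (ha : a ∈ A)
    (hmin : ∀ b ∈ A, (prodBernoulli w).real (openConn o a) ≤ (prodBernoulli w).real (openConn o b))
    (hcomb : ∀ b ∈ A, ∀ b' ∈ A, b ≠ a → b' ≠ a → b ≠ b' →
      (Finset.range (depth b + 1)).image (fun i => par^[i] b) ∩ (Finset.range (depth b' + 1)).image (fun i => par^[i] b') ⊆
        (Finset.range (depth a + 1)).image (fun i => par^[i] a))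
    (j : ℕ) (t : ℝ)
    (hEN : (2 * j : ℝ) < ∑ b ∈ A, (prodBernoulli w).real (openConn o b))
    (ht : ∀ b ∈ A, (prodBernoulli w).real (openConn o b : Set (BondConfig (Fin n)))ᶜ ≤ t) :
    (prodBernoulli w).real {ω : BondConfig (Fin n) | (A.filter fun b => ω ∈ openConn o b).card ≤ j} ≤ t := by
  rw [tree_relayCount_transfer n w o depth par hroot hstep hsupp A j]
  set q : Fin n → unitInterval := fun x => if x = o then 1 else w s(par x, x) with hq
  set P : Fin n → Finset (Fin n) :=
    fun x => if x = o then {o} else (Finset.range (depth x + 1)).image (fun i => par^[i] x) with hP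
  obtain ⟨_, h2, h3⟩ := tree_ancestor_axioms o depth par hstep
  have hAo : ∀ b ∈ A, b ≠ o := fun b hb hbo => hoA (hbo ▸ hb)
  -- the event
  have hevent : ∀ b, b ≠ o → ∀ ω' : Set (Fin n),
      (b = o ∨ ∀ i, i ≤ depth b → par^[i] b ∈ ω') ↔ ((P b : Finset (Fin n)) : Set (Fin n)) ⊆ ω' := by
    intro b hbo ω'
    simp only [hbo, false_or, hP, if_neg hbo, Finset.coe_image, Finset.coe_range, Set.image_subset_iff]
    constructor
    · intro h i hi
      exact h i (by simpa [Nat.lt_succ_iff] using hi)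
    · intro h i hi
      exact h (show i ∈ Set.Iio (depth b + 1) by simpa [Nat.lt_succ_iff] using hi)
  have hset : {ω' : Set (Fin n) | (A.filter fun b => b = o ∨ ∀ i, i ≤ depth b → par^[i] b ∈ ω').card ≤ j} =
      {ω' : Set (Fin n) | (A.filter fun b => ((P b : Finset (Fin n)) : Set (Fin n)) ⊆ ω').card ≤ j} := by
    ext ω'
    simp only [Set.mem_setOf_eq]
    rw [Finset.filter_congr fun b hb => hevent b (hAo b hb) ω']
  rw [hset]
  -- the marginals
  have hmarg : ∀ b ∈ A, ∏ y ∈ P b, (q y : ℝ) = (prodBernoulli w).real (openConn o b) := by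
    intro b hb
    have hbo := hAo b hb
    rw [tree_real_openConn_eq_prod n w o depth par hroot hstep hsupp b hbo]
    have hPb : P b = (Finset.range (depth b + 1)).image (fun i => par^[i] b) := by simp only [hP, if_neg hbo]
    rw [hPb, Finset.prod_image (tree_iterate_injOn o depth par hstep b hbo)]
    refine Finset.prod_congr rfl fun i hi => ?_
    have hne := (tree_iterate_par o depth par hstep b hbo i (by have := Finset.mem_range.1 hi; omega)).1
    simp [hq, hne]
  have hEN' : (2 * j : ℝ) < ∑ b ∈ A, ∏ y ∈ P b, (q y : ℝ) := by
    rw [Finset.sum_congr rfl hmarg]; exact hEN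
  have ht' : ∀ b ∈ A, 1 - ∏ y ∈ P b, (q y : ℝ) ≤ t := by
    intro b hb
    rw [hmarg b hb, ← probReal_compl_eq_one_sub (Set.toFinite _).measurableSet]
    exact ht b hb
  have hmin' : ∀ b ∈ A, ∏ y ∈ P a, (q y : ℝ) ≤ ∏ y ∈ P b, (q y : ℝ) := by
    intro b hb
    rw [hmarg a ha, hmarg b hb]
    exact hmin b hb
  have hcomb' : ∀ b ∈ A, ∀ b' ∈ A, b ≠ a → b' ≠ a → b ≠ b' → P b ∩ P b' ⊆ P a := by
    intro b hb b' hb' hba hb'a hbb'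
    have e1 : P b = (Finset.range (depth b + 1)).image (fun i => par^[i] b) := by simp only [hP, if_neg (hAo b hb)]
    have e2 : P b' = (Finset.range (depth b' + 1)).image (fun i => par^[i] b') := by simp only [hP, if_neg (hAo b' hb')]
    have e3 : P a = (Finset.range (depth a + 1)).image (fun i => par^[i] a) := by simp only [hP, if_neg (hAo a ha)]
    rw [e1, e2, e3]
    exact hcomb b hb b' hb' hba hb'a hbb'
  exact farTreeRow_comb n P h2 h3 q A j t a ha hmin' hcomb' hEN' ht'

/-- **FAR AT EVERY LAYER ON COMBS, route vocabulary.**  For weights on the pairs of `Fin n` supported on a rooted spanning tree (`par`/`depth`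
coordinates; weight `0` prunes), a relay set `A` with a least likely relay `a ∈ A`, `a ≠ o`, such that any two other relays of `A ∖ o` have their common
ancestors-or-self on `a`'s ancestral line (COMB), every layer `j` and every `t`: `2j < Σ_{b∈A} P(o ↔ b)` and `P(o ↮ b) ≤ t` (`b ∈ A`) imply
`P(#{b ∈ A | o ↔ b} ≤ j) ≤ t` — the body of `Quant.FarRelayRow` for this family, at every layer (`o ∈ A` allowed). [this work] -/
theorem farRelayRow_tree_comb (n : ℕ) (w : Sym2 (Fin n) → unitInterval) (o : Fin n)
    (depth : Fin n → ℕ) (par : Fin n → Fin n)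
    (hroot : ∀ x, x ≠ o → depth x = 0 → par x = o)
    (hstep : ∀ x, x ≠ o → depth x ≠ 0 → par x ≠ o ∧ depth (par x) + 1 = depth x)
    (hsupp : ∀ e, w e ≠ 0 → e.IsDiag ∨ ∃ x, x ≠ o ∧ e = s(par x, x))
    (A : Finset (Fin n)) (a : Fin n) (ha : a ∈ A) (hao : a ≠ o)
    (hmin : ∀ b ∈ A, (prodBernoulli w).real (openConn o a) ≤ (prodBernoulli w).real (openConn o b))
    (hcomb : ∀ b ∈ A, ∀ b' ∈ A, b ≠ a → b' ≠ a → b ≠ b' → b ≠ o → b' ≠ o →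
      (Finset.range (depth b + 1)).image (fun i => par^[i] b) ∩ (Finset.range (depth b' + 1)).image (fun i => par^[i] b') ⊆
        (Finset.range (depth a + 1)).image (fun i => par^[i] a))
    (j : ℕ) (t : ℝ)
    (hEN : (2 * j : ℝ) < ∑ b ∈ A, (prodBernoulli w).real (openConn o b))
    (ht : ∀ b ∈ A, (prodBernoulli w).real (openConn o b : Set (BondConfig (Fin n)))ᶜ ≤ t) :
    (prodBernoulli w).real {ω : BondConfig (Fin n) | (A.filter fun b => ω ∈ openConn o b).card ≤ j} ≤ t := by
  by_cases ho : o ∈ A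
  swap
  · exact farRelayRow_tree_comb_notMem n w o depth par hroot hstep hsupp A ho a ha hmin
      (fun b hb b' hb' hba hb'a hbb' => hcomb b hb b' hb' hba hb'a hbb' (fun h => ho (h ▸ hb)) (fun h => ho (h ▸ hb'))) j t hEN ht
  have ht0 : 0 ≤ t := le_trans measureReal_nonneg (ht o ho)
  have hcard := QuantCensus.card_filter_conn_eq_erase_add_one A o ho
  have hsum := QuantCensus.sum_conn_eq_one_add_erase w A o ho
  have hoA' : o ∉ A.erase o := Finset.notMem_erase o A
  have haA' : a ∈ A.erase o := Finset.mem_erase.2 ⟨hao, ha⟩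
  have hmin' : ∀ b ∈ A.erase o, (prodBernoulli w).real (openConn o a) ≤ (prodBernoulli w).real (openConn o b) :=
    fun b hb => hmin b (Finset.mem_of_mem_erase hb)
  have hcomb' : ∀ b ∈ A.erase o, ∀ b' ∈ A.erase o, b ≠ a → b' ≠ a → b ≠ b' →
      (Finset.range (depth b + 1)).image (fun i => par^[i] b) ∩ (Finset.range (depth b' + 1)).image (fun i => par^[i] b') ⊆
        (Finset.range (depth a + 1)).image (fun i => par^[i] a) :=
    fun b hb b' hb' hba hb'a hbb' => hcomb b (Finset.mem_of_mem_erase hb) b' (Finset.mem_of_mem_erase hb') hba hb'a hbb'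
      (Finset.mem_erase.1 hb).1 (Finset.mem_erase.1 hb').1
  rcases Nat.eq_zero_or_pos j with hj | hj
  · subst hj
    have hempty : {ω : BondConfig (Fin n) | (A.filter fun b => ω ∈ openConn o b).card ≤ 0} = ∅ := by
      rw [Set.eq_empty_iff_forall_notMem]
      intro ω hω
      have h1 := hcard ω
      have h2 : (A.filter fun b => ω ∈ openConn o b).card ≤ 0 := hω
      omega
    rw [hempty, measureReal_empty]
    exact ht0
  · obtain ⟨j', rfl⟩ : ∃ j', j = j' + 1 := ⟨j - 1, by omega⟩
    have hEN' : (2 * j' : ℝ) < ∑ b ∈ A.erase o, (prodBernoulli w).real (openConn o b : Set (BondConfig (Fin n))) := by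
      push_cast at hEN
      linarith
    have ht' : ∀ b ∈ A.erase o, (prodBernoulli w).real (openConn o b : Set (BondConfig (Fin n)))ᶜ ≤ t :=
      fun b hb => ht b (Finset.mem_of_mem_erase hb)
    have hfar := farRelayRow_tree_comb_notMem n w o depth par hroot hstep hsupp (A.erase o) hoA' a haA' hmin' hcomb' j' t hEN' ht'
    have hset : {ω : BondConfig (Fin n) | (A.filter fun b => ω ∈ openConn o b).card ≤ j' + 1} =
        {ω | ((A.erase o).filter fun b => ω ∈ openConn o b).card ≤ j'} := by
      ext ω
      simp only [Set.mem_setOf_eq]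
      rw [hcard ω]
      omega
    rw [hset]
    exact hfar

end Quant

end Summit.CriticalPhenomena.PercolationContinuityZ3.Theorems

end
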